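/-
Copyright (c) 2026. All rights reserved.
Released under Apache 2.0 license as described in the file LICENSE.
-/
import Literature.NumberTheory.Weil1964.AdelicMetaplecticThetaMajorantsConj
import Literature.NumberTheory.Weil1964.ArchPhaseMapSymplectic
import HarnessLib

/-!
# Weil's Lemme 5, pointwise adelic form, for a CONJUGATED homomorphism `h ↦ q · s(h) · q⁻¹`

Topic `NumberTheory/Weil1964`; namespace `Literature.NumberTheory.Weil1964`.  KERNEL mathematics only (theorems; no
definition, no named fact, no `axiom`, no proof hole).

Sequel of `AdelicMetaplecticThetaMajorantsConj` (the decay data of `h ↦ ω(q)ω(s h)Φ` for a FIXED `q ∈ Mp_ψ(W_𝔸)ᶜᵒⁿᵗ`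
and a continuous homomorphism `s : H → Mp_ψ(W_𝔸)ᶜᵒⁿᵗ` with an archimedean covariant family): with
`ω(q · s h · q⁻¹)Φ = ω(q)(ω(s h)(ω(q⁻¹)Φ))` and ★ `exists_piSchwartzBruhat_dominating_of_locally_uniform_decay`
([Weil1964, Chap. III n° 41, Lemme 5 p. 194]: finite subcover of a compact set) —

* **`exists_piSchwartzBruhat_dominating_omega_conj_comp`**: for every `Φ ∈ 𝒮(𝔸_Fⁿ)`, every compact `C ⊆ H` and EVERY
  `q ∈ Mp_ψ(W_𝔸)ᶜᵒⁿᵗ` there is ONE real non-negative `Φ₀ ∈ 𝒮(𝔸_Fⁿ)` with `‖(ω(q · s h · q⁻¹)Φ)(x)‖ ≤ (Φ₀ x).re` for all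
  `h ∈ C`, `x` (hypotheses = those of ★ `exists_piSchwartzBruhat_dominating_omega_comp` + a real frame `e`; the
  archimedean operator over `π(q)` comes from ★ `exists_MpS_over_archPhaseMap`);
* `…_of_kakData`: the same from `KAK` implementer data (hypotheses of ★
  `exists_piSchwartzBruhat_dominating_omega_comp_of_kakData` verbatim, plus `q`) — the form used by the unitary dual pairs.

No continuity of the conjugated homomorphism is used (left multiplication by a Fourier-type `q` is not weakly
continuous on `Mp_ψ(W_𝔸)ᶜᵒⁿᵗ`).  Cell hodgecm-mathlib FLOOR 0, engine E-2 (crux item H413): the δ♮-frame transport of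
input (DOM-C) of the `SW2c-BOUND` assembly — implementers over `conj(δ♮) ∘ ι(1 ⊗ ·)`.  HC_CM is proved only modulo the
printed citations until rung 0 closes; nothing here is about Hodge classes.

## References
* [Weil1964] A. Weil, *Sur certains groupes d'opérateurs unitaires*, Acta Math. 111 (1964) 143–211, Chap. III n° 39
  p. 189, n° 41 Lemme 5 p. 194.
* [Weil1965] A. Weil, *Sur la formule de Siegel dans la théorie des groupes classiques*, Acta Math. 113 (1965) 1–87,
  Chap. V n° 47, n° 50.
* [Folland1989] G. B. Folland, *Harmonic Analysis in Phase Space* (1989), Prop. (1.43), §4.2 (4.23).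
-/

set_option autoImplicit false

noncomputable section

open scoped Matrix SchwartzMap TensorProduct Topology Classical

open NumberField NumberField.mixedEmbedding IsDedekindDomain Set Filter

namespace Literature.NumberTheory.Weil1964

open Literature.NumberTheory.Automorphic Literature.RepresentationTheory.HeisenbergGroup
open Literature.Analysis.SegalBargmann

/-! ## The pointwise Lemme 5 for the conjugated homomorphism `h ↦ q · s(h) · q⁻¹` -/

section Conj

variable {F : Type} [Field F] [NumberField F] {n : ℕ} {T : Matrix (Fin n) (Fin n) (AdeleRing (𝓞 F) F)}
  {H : Type*} [Group H] [TopologicalSpace H] [IsTopologicalGroup H]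

/-- an archimedean covariant operator for a FIXED `q ∈ Mp_ψ(W_𝔸)ᶜᵒⁿᵗ` in a real frame `e`: the Schwartz-model
metaplectic group `Mp^𝓢(ℝ^σ)` has an element over the archimedean phase map of `π(q)` (★ `exists_MpS_over_archPhaseMap`),
pulled back to `𝓢(F_∞ⁿ)` by ★ `carrierConj` (as in ★ `carrierConjEquiv_archModTrans`). [folklore] -/
private theorem exists_archCovariant {σ : Type*} [Fintype σ] [DecidableEq σ]
    (e : (Fin n → mixedSpace F) ≃L[ℝ] (σ → ℝ)) (hT' : IsUnit (archMat F (Fin n) T)) (q : adelicMpCont F (Fin n) T) :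
    ∃ Wq : 𝓢((Fin n → mixedSpace F), ℂ) →L[ℂ] 𝓢((Fin n → mixedSpace F), ℂ), Wq ≠ 0 ∧
      ∀ (a w : Fin n → mixedSpace F) (Φ : 𝓢((Fin n → mixedSpace F), ℂ)),
        Wq (archModTrans F (Fin n) T a w Φ) =
          weilPhase T (adelicMpCont.proj F (Fin n) T q) (a, w) •
            archModTrans F (Fin n) T (archAct T (adelicMpCont.proj F (Fin n) T q) (a, w)).1
              (archAct T (adelicMpCont.proj F (Fin n) T q) (a, w)).2 (Wq Φ) := by
  have hex := exists_MpS_over_archPhaseMap T e hT' (adelicMpCont.proj F (Fin n) T q)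
  rcases hex with ⟨z, hz⟩
  have hcov : ∀ (p r : σ → ℝ) (f : SchwartzMap (σ → ℝ) ℂ), z.1.2 (rhoS p r f) =
      rhoS ((((MpS.proj z).1 : ((σ → ℝ) × (σ → ℝ)) ≃ₗ[ℝ] ((σ → ℝ) × (σ → ℝ))) : PhaseMap σ) (p, r)).1
        ((((MpS.proj z).1 : ((σ → ℝ) × (σ → ℝ)) ≃ₗ[ℝ] ((σ → ℝ) × (σ → ℝ))) : PhaseMap σ) (p, r)).2 (z.1.2 f) :=
    ((MpS.mem_iff_covariant _).1 z.2).1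
  have hA0 : (z.1.2 : SchwartzMap (σ → ℝ) ℂ →L[ℂ] SchwartzMap (σ → ℝ) ℂ) ≠ 0 := by
    intro h0
    have h1 : z.1.2 (hermitePi 0) = 0 := DFunLike.congr_fun h0 (hermitePi 0)
    exact hermitePi_ne_zero (σ := σ) 0 (z.1.2.injective (h1.trans (map_zero z.1.2).symm))
  have hA : ∀ (p r : σ → ℝ) (Ψ : 𝓢((Fin n → mixedSpace F), ℂ)),
      carrierConj e (z.1.2 : SchwartzMap (σ → ℝ) ℂ →L[ℂ] SchwartzMap (σ → ℝ) ℂ) (rhoSD e p r Ψ) =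
        rhoSD e (archPhaseMap T e hT' (adelicMpCont.proj F (Fin n) T q) (p, r)).1
          (archPhaseMap T e hT' (adelicMpCont.proj F (Fin n) T q) (p, r)).2
          (carrierConj e (z.1.2 : SchwartzMap (σ → ℝ) ℂ →L[ℂ] SchwartzMap (σ → ℝ) ℂ) Ψ) := by
    intro p r Ψ
    rw [← hz]
    exact carrierConj_rhoSD e hcov p r Ψ
  exact ⟨carrierConj e (z.1.2 : SchwartzMap (σ → ℝ) ℂ →L[ℂ] SchwartzMap (σ → ℝ) ℂ), carrierConj_ne_zero e hA0,
    fun a w Φ => arch_implements_of_covariant_rhoSD_clm T e hT' (adelicMpCont.proj F (Fin n) T q) _ hA a w Φ⟩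

set_option maxHeartbeats 3200000 in
/-- **Weil's Lemme 5, pointwise adelic form, for the CONJUGATED homomorphism `h ↦ q · s(h) · q⁻¹`** (`q ∈ Mp_ψ(W_𝔸)ᶜᵒⁿᵗ`
fixed; `s : H →* Mp_ψ(W_𝔸)ᶜᵒⁿᵗ` continuous with an archimedean `ψ_∞`-covariant family `W_∞` — the hypotheses of ★
`exists_piSchwartzBruhat_dominating_omega_comp` verbatim, plus any real frame `e` of `F_∞ⁿ`, used only to read the
archimedean phase map of `π(q)`): for every `Φ ∈ 𝒮(𝔸_Fⁿ)` and compact `C ⊆ H` there is ONE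
real non-negative `Φ₀ ∈ 𝒮(𝔸_Fⁿ)` with `‖(ω(q · s h · q⁻¹)Φ)(x)‖ ≤ (Φ₀ x).re` for all `h ∈ C`, `x ∈ 𝔸_Fⁿ`.  No continuity
of the conjugated homomorphism is used (left multiplication by `q` is not weakly continuous).
[cite: Weil1964, Chap. III n° 41, Lemme 5 p. 194] [cite: Weil1965, Chap. V n° 47, n° 50] -/
theorem exists_piSchwartzBruhat_dominating_omega_conj_comp (hT : IsUnit T) (s : H →* adelicMpCont F (Fin n) T)
    (hs : Continuous s)
    (Winf : H → (𝓢((Fin n → mixedSpace F), ℂ) →L[ℂ] 𝓢((Fin n → mixedSpace F), ℂ)))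
    (w0 : ∀ h, Winf h ≠ 0) (w1 : ∀ Φ, Continuous fun h => Winf h Φ)
    (w2 : ∀ (h : H) (a w : Fin n → mixedSpace F) (Φ : 𝓢((Fin n → mixedSpace F), ℂ)),
      Winf h (archModTrans F (Fin n) T a w Φ) =
        weilPhase T (adelicMpCont.proj F (Fin n) T (s h)) (a, w) •
          archModTrans F (Fin n) T (archAct T (adelicMpCont.proj F (Fin n) T (s h)) (a, w)).1
            (archAct T (adelicMpCont.proj F (Fin n) T (s h)) (a, w)).2 (Winf h Φ))
    {σ : Type*} [Fintype σ] [DecidableEq σ] (e : (Fin n → mixedSpace F) ≃L[ℝ] (σ → ℝ))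
    (hT' : IsUnit (archMat F (Fin n) T))
    (q : adelicMpCont F (Fin n) T) (Φ : piSchwartzBruhat F (Fin n)) {C : Set H} (hC : IsCompact C) :
    ∃ Φ₀ : (Fin n → AdeleRing (𝓞 F) F) → ℂ, Φ₀ ∈ piSchwartzBruhat F (Fin n) ∧
      (∀ x, (Φ₀ x).im = 0 ∧ 0 ≤ (Φ₀ x).re) ∧
        ∀ h ∈ C, ∀ x, ‖((adelicMpCont.omega F (Fin n) T (q * s h * q⁻¹) Φ : piSchwartzBruhat F (Fin n)) :
          (Fin n → AdeleRing (𝓞 F) F) → ℂ) x‖ ≤ (Φ₀ x).re := by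
  obtain ⟨Wq, hWq0, hWq⟩ := exists_archCovariant e hT' q
  have hd := fun (k : ℕ) (h₀ : H) => decay_near_conj hT s (map_mul s) hs Winf w0 w1 w2 q Wq hWq0 hWq
    (adelicMpCont.omega F (Fin n) T q⁻¹ Φ) k h₀
  have key := exists_piSchwartzBruhat_dominating_of_locally_uniform_decay F
    (fun h => adelicMpCont.omega F (Fin n) T q (adelicMpCont.omega F (Fin n) T (s h)
      (adelicMpCont.omega F (Fin n) T q⁻¹ Φ))) hd hC
  obtain ⟨Φ₀, hΦ₀, hr, hdom⟩ := key
  have heq : ∀ h, adelicMpCont.omega F (Fin n) T (q * s h * q⁻¹) Φ =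
      adelicMpCont.omega F (Fin n) T q (adelicMpCont.omega F (Fin n) T (s h)
        (adelicMpCont.omega F (Fin n) T q⁻¹ Φ)) := fun h =>
    LinearMap.congr_fun ((map_mul (adelicMpCont.omega F (Fin n) T) (q * s h) q⁻¹).trans
      (congrArg (· * adelicMpCont.omega F (Fin n) T q⁻¹) (map_mul (adelicMpCont.omega F (Fin n) T) q (s h)))) Φ
  refine ⟨Φ₀, hΦ₀, hr, fun h hh x => ?_⟩
  have h1 := hdom h hh x
  rw [← heq h] at h1
  exact h1

variable {σ : Type*} [Fintype σ] {G : Type*} [TopologicalSpace G] {K : Type*} [TopologicalSpace K]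
  {P : Type*} [TopologicalSpace P]

/-- **Lemme 5 for the conjugated homomorphism from `KAK` implementer data** (the hypotheses of ★
`exists_piSchwartzBruhat_dominating_omega_comp_of_kakData` verbatim, plus the fixed `q`): the form used by the unitary
dual pairs. [cite: Weil1964, Chap. III n° 41, Lemme 5 p. 194] [cite: Weil1965, Chap. V n° 47, n° 50] -/
theorem exists_piSchwartzBruhat_dominating_omega_conj_comp_of_kakData (hT : IsUnit T)
    (s : H →* adelicMpCont F (Fin n) T) (hs : Continuous s) (e : (Fin n → mixedSpace F) ≃L[ℝ] (σ → ℝ))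
    (hT' : IsUnit (archMat F (Fin n) T)) [DecidableEq σ] [Monoid G]
    {γ : G → PhaseMap σ} {κ : K → G} {a : P → G}
    {WK : K → (SchwartzMap (σ → ℝ) ℂ →L[ℂ] SchwartzMap (σ → ℝ) ℂ)}
    {WA : P → (SchwartzMap (σ → ℝ) ℂ →L[ℂ] SchwartzMap (σ → ℝ) ℂ)} (Dk : KAKImplementerData γ κ a WK WA)
    (ϖ : H → G) (hϖ : Continuous ϖ)
    (hγ : ∀ h, archPhaseMap T e hT' (adelicMpCont.proj F (Fin n) T (s h)) = γ (ϖ h))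
    (q : adelicMpCont F (Fin n) T) (Φ : piSchwartzBruhat F (Fin n)) {C : Set H} (hC : IsCompact C) :
    ∃ Φ₀ : (Fin n → AdeleRing (𝓞 F) F) → ℂ, Φ₀ ∈ piSchwartzBruhat F (Fin n) ∧
      (∀ x, (Φ₀ x).im = 0 ∧ 0 ≤ (Φ₀ x).re) ∧
        ∀ h ∈ C, ∀ x, ‖((adelicMpCont.omega F (Fin n) T (q * s h * q⁻¹) Φ : piSchwartzBruhat F (Fin n)) :
          (Fin n → AdeleRing (𝓞 F) F) → ℂ) x‖ ≤ (Φ₀ x).re :=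
  exists_piSchwartzBruhat_dominating_omega_conj_comp hT s hs (fun h => carrierConj e (vacSection γ (ϖ h)))
    (fun h => carrierConj_ne_zero e (Dk.vacSection_ne_zero (ϖ h)))
    (fun Φ => continuous_carrierConj_apply e (fun f => (Dk.continuous_apply_vacSection f).comp hϖ) Φ)
    (fun h a' w Φ => arch_implements_of_covariant_rhoSD_clm T e hT' (adelicMpCont.proj F (Fin n) T (s h))
      (carrierConj e (vacSection γ (ϖ h)))
      (fun p r Ψ => carrierConj_rhoSD e (φ := archPhaseMap T e hT' (adelicMpCont.proj F (Fin n) T (s h)))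
        (fun p' r' f => by rw [hγ h]; exact (Dk.isImplementerS_vacSection (ϖ h)).1 p' r' f) p r Ψ) a' w Φ)
    e hT' q Φ hC

end Conj

end Literature.NumberTheory.Weil1964

end
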